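import Summits.Schanuel.Schanuel.Theorems.RootDecomp1BRadicalDescent03
import Mathlib.Analysis.Analytic.IsolatedZeros
import Mathlib.Analysis.Complex.CauchyIntegral
import Mathlib.Algebra.MvPolynomial.Funext
import Mathlib.Data.Finsupp.Encodable

/-!
# RootDecomp1EGenericScale — lens 2, generation 38 «GENERIC-SCALE INDUCTION STEP» (kernel: radical descent over an arbitrary type function; cells below the E-R19 floor) — part 1 (RootDecomp1EGenericScale01): §1 `relTypeFn` and §2 `TypeLiouville`

PORT NOTE (census-1 gen 16, 2026-08-31): port of [HOME/decomp-schanuel-lens-2/g38/GenericScale.lean EDITION 2 sha256 cf4f06e4…1307, 1762 l (ed.1 b58a0d29…; proof-only reshape `type_clash`, NOTE/EDITION2 L1842, writer re-check L1845) + GenericScaleCtrl ed.2 84ae4551… + NODE-g38.md ffd0a60c…; NODE L1822 / REQUEST L1823; critic ACK + OBJECTION L1800, VERDICT L1833]; own farm rc 0 · 0 warn · 0 sorry · axioms std;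
critic VERDICT L1833: CLEARED and BOOKED (A)–(D), NO credit (E-R19 conceded) — (A) the KERNEL THEOREM-grade / VARIANT-REACH, port welcome `--supports stmt-Schanuel-31409`; (B) the
(b)-cells BELOW THE E-R19 FLOOR, port welcome in the same chain with the Theses-import part LAST; (C) the GENERICITY FLOOR = separate chain `RootDecomp1EGenericityFloor01–03`. Six parts
`RootDecomp1EGenericScale01`–`06` (census PORT HAND-BACK L1834 answered by lens-2's EDITION 2): 01 = §1 the relative type function `relTypeFn` + §2 `TypeLiouville` (density), 02 = §3 the private
estimates + the extracted `type_clash`, 03 = §3 THE KERNEL `algebraicIndependent_radical_of_type` (one 365-line declaration; `maxHeartbeats 1600000` as in the source), 04 = `algebraicIndependent_radical_generic`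
+ §4 plumbing (anchored maximal a.i. coordinate sets, `trdeg_adjoin_le_card`, `coordFamily`, `defect_step`), 05 = §5 the class `InGenericScaleClass` and the cells against the LIVE items of route 1E
(`eStableDefectOne_genericScaleCell`, `plainDefectOne_genericScaleCell`, `defectOneSchanuel_genericScaleStep`, `schanuel_genericScaleLine_of_defectOne`; item texts by `Iff.rfl`) — the FIRST part importing
`Summits.Schanuel.Schanuel.Theses.RootDecomp1E` —, 06 = §6 members (`dense_genericScale`, `zG ρ = (1, i, e, ie, ρ, iρ)`, `exists_member`, `item31409_applied_at_zG`, `item31409_instance_at_zG`; imports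
`Literature.NumberTheory.Transcendental.PeriodsWave0Proofs`). §7 (the floor) is NOT repeated here. PORT EDITS: `set_option linter.dupNamespace false` dropped; 19 one-line docstrings added; seven
helpers with tree/floor twins private (`ofReal_exp_one`, `isAlgebraic_I`, `I_notMem_range_rat`, `coordFamily_castAdd/natAdd`, `range_coordFamily`, `trdeg_adjoin_le_card`); statements and proofs otherwise
verbatim. `--supports stmt-Schanuel-31409`; no census credit; nothing here proves Schanuel; rung 0. The lens's header follows.
-/

/-!
# RootDecomp1EGenericScale (EDITION 2 — proof-only reshape: `type_clash` extracted; statements byte-identical to edition 1) — lens 2, generation 38 «GENERIC-SCALE INDUCTION STEP» (RULE E-R18 (b))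

An INDUCTION-STEP cell for the first-failure items of route `RootDecomp1E`
(`EStableDefectOne` = stmt-Schanuel-31409, `PlainDefectOne` = stmt-Schanuel-31410) and for
`DefectOneSchanuel` (stmt-Schanuel-25020): the first-failure binder (defect ≤ 1 on the proper free
sub-tuples) is CONSUMED, on a class that no engine decides outright.

## The mechanism

* §1 `relTypeFn v D L` — the RELATIVE TYPE FUNCTION of a tuple `v : Fin N → ℂ`: the least NON-ZERO
  value `‖P(v)‖` over the finite box `deg P ≤ D`, `len P ≤ L` (`P ∈ ℤ[X]`), capped by `1`. It is
  positive for EVERY tuple (finitely many values) and antitone in `D`, `L`; for an algebraically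
  independent coordinate sub-family `θ = v ∘ emb` it is a measure of algebraic independence of `θ`.
* §2 `TypeLiouville φ ρ` — `ρ` admits, for every `m`, a rational `r ≠ ρ` with `den r ≥ m` and
  `|ρ − r| < exp(−den³) · φ(den², 2^{den³})`; for every positive `φ` a dense `G_δ` of reals.
* §3 KERNEL `algebraicIndependent_radical_of_type`: lens-4's radical descent
  (`RootDecomp1BRadicalDescent04.algebraicIndependent_radical`) RE-PROVED with the degree-uniform
  measure `DExpMeasure θ` replaced by an ARBITRARY antitone type function `φ ≤ 1` of `θ` and
  `UltraLiouville ρ` by `TypeLiouville φ ρ`: then `(e^{ρ y₀}, ρ, θ)` is algebraically independent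
  whenever `e^{y₀}` is a coordinate of `θ` and `ρ > 0`. The algebra (norm-form matrix, formal
  non-vanishing, eigenvalue factorisation, size bounds) is the tree's `RootDecomp1BRadicalDescent01–03`
  BY NAME; only the clash changes (`φ(q², 2^{q³}) ≤ ‖N(θ)‖ < (Kl+1)·e^{cU q²}·e^{−q³}·φ(q², 2^{q³})`).
* §4 plumbing: a maximal algebraically independent COORDINATE set through a transcendental coordinate
  (anchored variant of `Literature…TrdegZariskiDim.exists_finset_algebraicIndependent_maximal`),
  `trdeg_adjoin_le_card`, the coordinate family `coordFamily w = (w, e^w)`, the one-step defect lemma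
  `defect_step`.
* §5 the class `InGenericScaleClass z` and the CELLS: `z ⊇ (w, ρ · w_{i₀})` with `w = z ∘ ι` an
  `m`-sub-tuple (`n ≤ m + 2`), `e^{w_{i₀}}` transcendental, `ρ > 0` type-Liouville relative to the
  coordinate tuple `(w, e^w)`; the first-failure binder at `(m, w)` gives `m ≤ trdeg ℚ(w, e^w) + 1`,
  hence an a.i. coordinate set `S ∋ e^{w_{i₀}}` with `#S ≥ m − 1`; the kernel adds `e^{ρ w_{i₀}}`
  and `ρ`: `trdeg ℚ(z, e^z) ≥ m + 1 ≥ n − 1`.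
* §6 members (existence is by density: `ρ` must out-run the — unknown — type of `(w, e^w)`),
  E-stable members `(1, i, e, ie, ρ, iρ)` at `n = 6` whose induction hypothesis
  `trdeg ℚ(e, e^i, e^e, e^{ie}) ≥ 3` is OPEN (separation from the earlier lens-2 classes and the
  axiom guards are in the companion `GenericScaleCtrl.lean`).
* §7 THE GENERICITY FLOOR (critic's RULE E-R19, STATUS L1800) TYPED AND PROVED — the yardstick every
  «generic-parameter» cell is now measured against: for EVERY `w : Fin m → ℂ`, `w_{i₀} ≠ 0`, all but
  COUNTABLY many complex (hence real) `u` give `trdeg ℚ(z, e^z) ≥ trdeg ℚ(w, e^w) + 2` for every tuple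
  `z ⊇ (w, u·w_{i₀})` (`countable_bad_scales_complex / _range / countable_bad_scales /
  floor_of_embedding`), whence `S⁻(w) ⇒ S(z)` and `S(w) ⇒ S(z)` off a countable set
  (`countable_not_schanuel_of_defectOne / _of_schanuel`). Ingredients, all proved here: an unanchored
  maximal a.i. coordinate set, countability of the zeros of a non-trivial entire function (isolated
  zeros + compact exhaustion), and the algebraic independence of the FUNCTIONS `t`, `e^{ct}` over
  `ℚ(θ)` (`exists_expPoly_ne_zero`: periodicity of `exp`, a polynomial with infinitely many roots
  vanishes, `MvPolynomial.funext_set`).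

## Status after the critic's pre-emptive objection (L1800, RULE E-R19 «genericity floor»)

* §3 kernel = a clean GENERALISATION of lens-4's radical descent (type function in place of the
  `DExpMeasure`): VARIANT-REACH, THEOREM-grade, port welcome (`--supports stmt-Schanuel-31409`); no cell
  credit by itself.
* §5 cells: typed with the item binders VERBATIM and the induction hypothesis CONSUMED — but their
  members are certified only by density of `TypeLiouville (relTypeFn v)` over the free real scale `ρ`,
  and their conclusion (`defect ≤ 1` for `z`) is IMPLIED — indeed out-done (`defect 0` from `S⁻(w)`) — by
  the floor of §7 for all but countably many `ρ`: (F2) fails. (F1) — an EXPLICIT member — is out of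
  reach IN PRINCIPLE for a type/approximation engine: certifying `TypeLiouville (relTypeFn (w, e^w)) ρ`
  for a named `ρ` requires an effective relative transcendence measure of an `(m − 1)`-element
  coordinate sub-family of `(w, e^w)`, i.e. that family KNOWN algebraically independent, i.e. the
  induction hypothesis decided outright (E-R18 «IH discharge» ⇒ VARIANT). So the (b)-cells are booked
  BELOW THE FLOOR (THEOREM-grade port material, no credit claimed), and the lens records the structural
  finding «(b) ∧ (F1) is empty for approximation engines» in its NODE.

HOME-only kernel (lens-2 g38); nothing here is typed into the tree by the lens.
-/

noncomputable section

open Complex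

namespace Summit.Schanuel.Schanuel.Theorems.RootDecomp1EGenericScale

open MvPolynomial
open Summit.Schanuel.Schanuel.Theorems.RootDecomp1KHyper (mvlen mvlen_nonneg abs_coeff_le_mvlen one_le_mvlen
  exists_ball_eval_ne_zero)
open Summit.Schanuel.Schanuel.Theorems.RootDecomp1BRadicalDescent

/-! ## §1 The relative type function of a tuple -/

section TypeFn

variable {N : ℕ}

/-- The box of integer polynomials of total degree `≤ D` and length `≤ L` is finite. -/
theorem finite_box (N D : ℕ) (L : ℤ) :
    {P : MvPolynomial (Fin N) ℤ | P.totalDegree ≤ D ∧ mvlen P ≤ L}.Finite := by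
  classical
  let B : Finset (Fin N →₀ ℕ) :=
    (Finset.univ : Finset (Fin N → Fin (D + 1))).image
      (fun f => Finsupp.equivFunOnFinite.symm (fun i => (f i : ℕ)))
  have hB : ∀ P : MvPolynomial (Fin N) ℤ, P.totalDegree ≤ D → P.support ⊆ B := by
    intro P hP s hs
    refine Finset.mem_image.mpr ⟨fun i => ⟨s i, Nat.lt_succ_of_le ?_⟩, Finset.mem_univ _, ?_⟩
    · exact (monomial_le_degreeOf i hs).trans ((degreeOf_le_totalDegree P i).trans hP)
    · ext i; simp
  let F : (B → Set.Icc (-L) L) → MvPolynomial (Fin N) ℤ :=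
    fun c => ∑ s : B, monomial (s : Fin N →₀ ℕ) ((c s : ℤ))
  refine (Set.finite_range F).subset ?_
  rintro P ⟨hD, hL⟩
  have hcoef : ∀ s : B, P.coeff s ∈ Set.Icc (-L) L := fun s =>
    abs_le.mp ((abs_coeff_le_mvlen P s).trans hL)
  refine ⟨fun s => ⟨P.coeff s, hcoef s⟩, ?_⟩
  show ∑ s : B, monomial (s : Fin N →₀ ℕ) (P.coeff s) = P
  rw [Finset.sum_coe_sort B (fun s => monomial s (P.coeff s)),
    ← Finset.sum_subset (hB P hD) (fun s _ hs => by rw [notMem_support_iff.mp hs, map_zero])]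
  exact (MvPolynomial.as_sum P).symm

/-- The candidate values of the relative type function: `1` and the NON-ZERO values `‖P(v)‖` over
the box `deg P ≤ D`, `len P ≤ L`. -/
def typeVals (v : Fin N → ℂ) (D L : ℕ) : Set ℝ :=
  insert 1 ((fun P : MvPolynomial (Fin N) ℤ => ‖aeval v P‖) ''
    {P : MvPolynomial (Fin N) ℤ | P.totalDegree ≤ D ∧ mvlen P ≤ (L : ℤ) ∧ aeval v P ≠ 0})

/-- The set of type values in a box is finite. -/
theorem typeVals_finite (v : Fin N → ℂ) (D L : ℕ) : (typeVals v D L).Finite :=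
  (((finite_box N D L).subset fun _ hP => ⟨hP.1, hP.2.1⟩).image _).insert 1

/-- `1` is a type value. -/
theorem one_mem_typeVals (v : Fin N → ℂ) (D L : ℕ) : (1 : ℝ) ∈ typeVals v D L :=
  Set.mem_insert _ _

/-- Type values are positive. -/
theorem typeVals_pos (v : Fin N → ℂ) (D L : ℕ) : ∀ x ∈ typeVals v D L, 0 < x := by
  rintro x (rfl | ⟨P, hP, rfl⟩)
  · exact one_pos
  · exact norm_pos_iff.mpr hP.2.2

/-- Monotonicity of the type-value sets. -/
theorem typeVals_mono (v : Fin N → ℂ) {D D' L L' : ℕ} (hD : D ≤ D') (hL : L ≤ L') :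
    typeVals v D L ⊆ typeVals v D' L' := by
  refine Set.insert_subset_insert (Set.image_mono ?_)
  rintro P ⟨h1, h2, h3⟩
  exact ⟨h1.trans hD, h2.trans (by exact_mod_cast hL), h3⟩

/-- **The relative type function** of the tuple `v`: the least non-zero `‖P(v)‖` over the box
`deg P ≤ D`, `len P ≤ L`, capped by `1`. -/
def relTypeFn (v : Fin N → ℂ) (D L : ℕ) : ℝ := sInf (typeVals v D L)

/-- The relative type function takes a value in the type-value set. -/
theorem relTypeFn_mem (v : Fin N → ℂ) (D L : ℕ) : relTypeFn v D L ∈ typeVals v D L :=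
  Set.Nonempty.csInf_mem ⟨1, one_mem_typeVals v D L⟩ (typeVals_finite v D L)

/-- positivity — for EVERY tuple `v` (no Diophantine input). -/
theorem relTypeFn_pos (v : Fin N → ℂ) (D L : ℕ) : 0 < relTypeFn v D L :=
  typeVals_pos v D L _ (relTypeFn_mem v D L)

/-- `relTypeFn v D L ≤ 1`. -/
theorem relTypeFn_le_one (v : Fin N → ℂ) (D L : ℕ) : relTypeFn v D L ≤ 1 :=
  csInf_le (typeVals_finite v D L).bddBelow (one_mem_typeVals v D L)

/-- antitone in the box -/
theorem relTypeFn_anti (v : Fin N → ℂ) {D D' L L' : ℕ} (hD : D ≤ D') (hL : L ≤ L') :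
    relTypeFn v D' L' ≤ relTypeFn v D L :=
  csInf_le_csInf (typeVals_finite v D' L').bddBelow ⟨1, one_mem_typeVals v D L⟩
    (typeVals_mono v hD hL)

/-- the defining lower bound: every NON-ZERO value in the box is at least the type function -/
theorem relTypeFn_le (v : Fin N → ℂ) {D L : ℕ} {P : MvPolynomial (Fin N) ℤ}
    (hD : P.totalDegree ≤ D) (hL : mvlen P ≤ (L : ℤ)) (hP : aeval v P ≠ 0) :
    relTypeFn v D L ≤ ‖aeval v P‖ :=
  csInf_le (typeVals_finite v D L).bddBelow (Set.mem_insert_of_mem _ ⟨P, ⟨hD, hL, hP⟩, rfl⟩)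

/-- Lengths are invariant under injective renaming of the variables. -/
theorem mvlen_rename_of_injective {k : ℕ} (f : Fin k → Fin N) (hf : Function.Injective f)
    (Q : MvPolynomial (Fin k) ℤ) : mvlen (rename f Q) = mvlen Q := by
  classical
  unfold mvlen
  rw [support_rename_of_injective hf, Finset.sum_image
    (fun a _ b _ h => Finsupp.mapDomain_injective hf h)]
  refine Finset.sum_congr rfl fun s _ => ?_
  rw [coeff_rename_mapDomain f hf]

/-- An integer polynomial vanishing at an algebraically independent tuple is zero. -/
theorem aeval_ne_zero_of_algebraicIndependent {k : ℕ} {θ : Fin k → ℂ}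
    (hθ : AlgebraicIndependent ℚ θ) {Q : MvPolynomial (Fin k) ℤ} (hQ : Q ≠ 0) : aeval θ Q ≠ 0 := by
  intro h
  have h1 : MvPolynomial.map (algebraMap ℤ ℚ) Q ≠ 0 := fun h0 =>
    hQ (MvPolynomial.map_injective _ (algebraMap ℤ ℚ).injective_int (by rw [h0, map_zero]))
  refine h1 (hθ ?_)
  rw [map_zero, MvPolynomial.aeval_map_algebraMap ℚ θ Q]
  exact h

/-- **The type function of a tuple is a measure of algebraic independence of each of its
algebraically independent coordinate sub-families.** -/
theorem relTypeFn_le_of_subfamily (v : Fin N → ℂ) {k : ℕ} (f : Fin k → Fin N)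
    (hf : Function.Injective f) (hθ : AlgebraicIndependent ℚ (v ∘ f))
    (Q : MvPolynomial (Fin k) ℤ) (hQ : Q ≠ 0) :
    relTypeFn v Q.totalDegree (mvlen Q).toNat ≤ ‖aeval (v ∘ f) Q‖ := by
  have hval : aeval v (rename f Q) = aeval (v ∘ f) Q := aeval_rename _ _ _
  rw [← hval]
  refine relTypeFn_le v (totalDegree_rename_le f Q) ?_ ?_
  · rw [mvlen_rename_of_injective f hf, Int.toNat_of_nonneg (mvlen_nonneg Q)]
  · rw [hval]; exact aeval_ne_zero_of_algebraicIndependent hθ hQ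

end TypeFn

/-! ## §2 Type-Liouville reals -/

section TypeLiouville

open Summit.Schanuel.Schanuel.Theorems.RootDecomp1KHyper.HyperCell (exists_rat_den_ge_near)

/-- the approximation threshold attached to a type function: `ψ_φ(q) = exp(−q³) · φ(q², 2^{q³})` -/
def psiOf (φ : ℕ → ℕ → ℝ) (q : ℕ) : ℝ := Real.exp (-((q : ℝ) ^ 3)) * φ (q ^ 2) (2 ^ (q ^ 3))

/-- The auxiliary function `psiOf` is positive. -/
theorem psiOf_pos {φ : ℕ → ℕ → ℝ} (hφ : ∀ D L, 0 < φ D L) (q : ℕ) : 0 < psiOf φ q :=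
  mul_pos (Real.exp_pos _) (hφ _ _)

/-- **Type-Liouville reals** relative to the type function `φ`: for every `m` a rational `r ≠ ρ`
with `den r ≥ m` and `|ρ − r| < exp(−den³) · φ(den², 2^{den³})`. -/
def TypeLiouville (φ : ℕ → ℕ → ℝ) (ρ : ℝ) : Prop :=
  ∀ m : ℕ, ∃ r : ℚ, m ≤ r.den ∧ ρ ≠ r ∧ |ρ - r| < psiOf φ r.den

open Topology in
/-- **Type-Liouville reals are dense** for every positive `φ` (Baire: a dense `G_δ`). Verbatim
adaptation of the tree's `RootDecomp1BRadicalDescent02.dense_setOf_ultraLiouville`. -/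
theorem dense_setOf_typeLiouville {φ : ℕ → ℕ → ℝ} (hφ : ∀ D L, 0 < φ D L) :
    Dense {ρ : ℝ | TypeLiouville φ ρ} := by
  let U : ℕ → Set ℝ := fun m => ⋃ r : {r : ℚ // m ≤ r.den},
    Metric.ball ((r : ℚ) : ℝ) (psiOf φ (r : ℚ).den) \ {((r : ℚ) : ℝ)}
  have hsub : (⋂ m, U m) ⊆ {ρ : ℝ | TypeLiouville φ ρ} := by
    intro ρ hρ m
    have hm := Set.mem_iInter.mp hρ m
    obtain ⟨⟨r, hr⟩, hmem⟩ := Set.mem_iUnion.mp hm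
    refine ⟨r, hr, fun h => hmem.2 (by simpa using h), ?_⟩
    have := hmem.1
    rw [Metric.mem_ball, Real.dist_eq] at this
    exact this
  refine Dense.mono hsub (dense_iInter_of_isOpen (fun m => ?_) (fun m => ?_))
  · exact isOpen_iUnion fun r => Metric.isOpen_ball.sdiff isClosed_singleton
  · rw [Metric.dense_iff]
    intro x ε hε
    obtain ⟨r, hr, hxr⟩ := exists_rat_den_ge_near x (half_pos hε) m
    have hψ : 0 < psiOf φ r.den := psiOf_pos hφ _
    set t : ℝ := min (psiOf φ r.den) ε / 2 with ht
    have ht0 : 0 < t := by rw [ht]; exact div_pos (lt_min hψ hε) two_pos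
    have hte : t < psiOf φ r.den := by
      have := min_le_left (psiOf φ r.den) ε
      rw [ht]; linarith
    have htε : t ≤ ε / 2 := by
      have := min_le_right (psiOf φ r.den) ε
      rw [ht]; linarith
    refine ⟨(r : ℝ) + t, ?_, ?_⟩
    · rw [Metric.mem_ball, Real.dist_eq]
      calc |(r : ℝ) + t - x| = |t + (r - x)| := by ring_nf
        _ ≤ |t| + |(r : ℝ) - x| := abs_add_le _ _
        _ < ε / 2 + ε / 2 := by
            rw [abs_of_pos ht0, abs_sub_comm]
            exact add_lt_add_of_le_of_lt htε hxr
        _ = ε := by ring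
    · refine Set.mem_iUnion.mpr ⟨⟨r, hr⟩, ?_, ?_⟩
      · rw [Metric.mem_ball, Real.dist_eq]
        simpa [abs_of_pos ht0] using hte
      · simp only [Set.mem_singleton_iff]
        intro h
        have : t = 0 := by linarith
        exact ht0.ne' this

/-- positive type-Liouville reals exist, for every positive `φ` -/
theorem exists_pos_typeLiouville {φ : ℕ → ℕ → ℝ} (hφ : ∀ D L, 0 < φ D L) :
    ∃ ρ : ℝ, 0 < ρ ∧ TypeLiouville φ ρ := by
  obtain ⟨ρ, hρ, hρpos⟩ :=
    (dense_setOf_typeLiouville hφ).exists_mem_open isOpen_Ioi ⟨1, Set.mem_Ioi.mpr one_pos⟩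
  exact ⟨ρ, Set.mem_Ioi.mp hρpos, hρ⟩

/-- type-Liouville reals are dense in every open interval: uncountably … (comeagre) many members -/
theorem dense_pos_typeLiouville {φ : ℕ → ℕ → ℝ} (hφ : ∀ D L, 0 < φ D L) {a b : ℝ} (hab : a < b) :
    ∃ ρ : ℝ, a < ρ ∧ ρ < b ∧ TypeLiouville φ ρ := by
  have hmid : (a + b) / 2 ∈ Set.Ioo a b := Set.mem_Ioo.mpr ⟨by linarith, by linarith⟩
  obtain ⟨ρ, hρ, hmem⟩ := (dense_setOf_typeLiouville hφ).exists_mem_open isOpen_Ioo ⟨_, hmid⟩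
  exact ⟨ρ, hmem.1, hmem.2, hρ⟩

end TypeLiouville

end Summit.Schanuel.Schanuel.Theorems.RootDecomp1EGenericScale

end
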